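import Mathlib
import HarnessLib
import Summits.HubbardSuperconductivity.HubbardSuperconductivity.Theorems.KLProgrammeKLRegimeTwoVolumeSiteKernel

/-!
# Route `KLProgramme` — ENGINE child `KLRegimeEngineV16` (stmt-HubbardSuperconductivity-20236), `stub_twoLeg_scale0`, conjunct
# (E3f-AT)₀, spatial nested leg `hsp`: the DRESSED read-out — interpolant of `Re[a(p_k⃗)·Σ(k⃗)]` at two nested volumes for a SAMPLED
# symbol `a` (cell gate-hubbard-kl, seat hubbard-kl-k3c5-p2 g6, β′ lane, step (m5)-c, part 2)

Sequel of `…TwoVolumeSiteKernel`.  The K-resummed two-leg reading ([tree] `selfEnergy_effAction_add_counterQuadratic`) produces the localised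
value as `Re E(p_k⃗) + Re[τ(p_k⃗)·Σ̃(k⃗)]`: an explicit sampled symbol plus a sampled symbol TIMES the self-energy of the purely quartic
resummed theory.  `…TwoVolumeSymInterp` §4 handles the first; this file handles data of the second shape, `f_L(k⃗) = Re[a(p_k⃗)·Σ_{G_L}((ω,k⃗),σ)]`
with `G_L = map S_L W_L` a grid representation and `a` ANY complex continuum symbol:

* §1 cosine coefficients of even data `Re F` are `Re (torusFourierInv F)` (`torusCosCoeff_re_eq_re_torusFourierInv_of_even`), so for the
  dressed data they are the real part of the CONVOLUTION `ǎ_L ∗ σ_L` of the sampled symbol's site kernel `ǎ_L = torusFourierInv (a ∘ p_L)` with the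
  complex site kernel `σ_L` of the string (`torusCosCoeff_dressed_eq_re_conv`);
* §2 periodisation: `Per(ǎ_f ∗ σ_f) = ǎ_c ∗ Per σ_f` (sampled symbols periodise exactly, convolution commutes with periodisation —
  [tree] `periodise_torusFourierInv_sampled`, `periodise_conv`), hence by Young
  `Σ_{x̄} ‖(ǎ_c ∗ σ_c)(x̄) − Per(ǎ_f ∗ σ_f)(x̄)‖ ≤ ‖ǎ_c‖₁ · Σ_{x̄} ‖σ_c(x̄) − Per σ_f(x̄)‖` (`sum_norm_conv_sub_periodise_conv_le`);
* §3 **`abs_eval_symInterp_dressed_sub_le`** — THE DRESSED READ-OUT: for nested volumes `Lf = b·Lc` on the common time grid, the block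
  embedding `ι`, base point at the origin, base-point–independent rows and even dressed data,
  `|(symInterp Lc f_c).eval q − (symInterp Lf f_f).eval q| ≤ ‖ǎ_c‖₁·(2N/|β|)·Def + 2·(2N/|β|)·(M₁(ǎ_f)·N₂ + ‖ǎ_f‖₁·M₂)/((Lc−1)/2+1)`,
  where `Def` is the pinned two-leg grid defect at the block-centre pin (the quantity β′ bounds), `N₂ = Σ_{p₁'} ‖W'(ι o, p₁')‖` the fine pinned
  profile and `M₂ = Σ_{p₁'} tnorm(x' p₁')·‖W'(ι o, p₁')‖` its first spatial moment — every Grassmann input is a PINNED sum at ONE pin.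

Proofs only; no definitions; nothing is asserted about the model.
-/

noncomputable section

namespace Summit.HubbardSuperconductivity.HubbardSuperconductivity.Theorems.TwoVolumeDefect

set_option linter.dupNamespace false -- summit = problem name (single-conjunct summit), D-0017

open Finset Complex Literature.MathematicalPhysics.QuantumLattice Literature.Probability.LatticeModels GrassmannAlgebra
open Summit.HubbardSuperconductivity.HubbardSuperconductivity.Theorems.KLRegimeSplit
open Summit.HubbardSuperconductivity.HubbardSuperconductivity.Theorems.TwoPointAssembly
open Summit.HubbardSuperconductivity.HubbardSuperconductivity.Theorems.TwoLegFourier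
open scoped ComplexConjugate

/-! ## §1 Cosine coefficients of dressed data are the real part of a convolution -/

section OneVolume

variable {L M : ℕ} [NeZero L]

/-- For even complex data, `torusCosCoeff L (Re F) y = Re (torusFourierInv F y)`. -/
theorem torusCosCoeff_re_eq_re_torusFourierInv_of_even (F : TorusSite 2 L → ℂ) (heven : ∀ k, F (-k) = F k) (y : TorusSite 2 L) :
    torusCosCoeff L (fun k => (F k).re) y = (torusFourierInv F y).re := by
  rw [torusCosCoeff_re_eq_of_even F heven y, torusFourierInv_eq_sum_torusChar]
  have hL : (((L : ℂ) ^ 2)⁻¹) = ((((L : ℝ) ^ 2)⁻¹ : ℝ) : ℂ) := by push_cast; ring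
  rw [hL, Complex.re_ofReal_mul]

/-- **Dressed data: the cosine coefficients are `Re (ǎ_L ∗ σ_L)`** — for `f(k⃗) = Re[a(p_k⃗)·Σ(k⃗)]` with `k⃗ ↦ a(p_k⃗)Σ(k⃗)` even,
`c_f(y) = Re Σ_z torusFourierInv (a∘p_L) z · torusFourierInv Σ (y − z)`. -/
theorem torusCosCoeff_dressed_eq_re_conv (a : (Fin 2 → ℝ) → ℂ) (Sg : TorusSite 2 L → ℂ)
    (heven : ∀ k : TorusSite 2 L, a (latticeMomentum L (-k)) * Sg (-k) = a (latticeMomentum L k) * Sg k) (y : TorusSite 2 L) :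
    torusCosCoeff L (fun k => (a (latticeMomentum L k) * Sg k).re) y =
      (∑ z : TorusSite 2 L, torusFourierInv (fun k => a (latticeMomentum L k)) z * torusFourierInv Sg (y - z)).re := by
  rw [torusCosCoeff_re_eq_re_torusFourierInv_of_even (fun k => a (latticeMomentum L k) * Sg k) heven y, torusFourierInv_mul_eq_conv]

end OneVolume

/-! ## §2 Periodisation of the dressed kernel and Young -/

section Periodise

variable {d b Lc Lf : ℕ} [NeZero Lc] [NeZero Lf]

/-- **`Per(ǎ_f ∗ σ_f) = ǎ_c ∗ Per σ_f`** for a sampled symbol `a`. -/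
theorem periodise_conv_sampled (hL : Lf = b * Lc) (a : (Fin d → ℝ) → ℂ) (σf : TorusSite d Lf → ℂ) (xbar : TorusSite d Lc) :
    ∑ y ∈ univ.filter (fun y : TorusSite d Lf => (fun i => (((y i).val : ℕ) : ZMod Lc)) = xbar),
        ∑ z : TorusSite d Lf, torusFourierInv (fun k => a (latticeMomentum Lf k)) z * σf (y - z) =
      ∑ zbar : TorusSite d Lc, torusFourierInv (fun k => a (latticeMomentum Lc k)) zbar *
        ∑ w ∈ univ.filter (fun w : TorusSite d Lf => (fun i => (((w i).val : ℕ) : ZMod Lc)) = xbar - zbar), σf w := by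
  rw [periodise_conv hL]
  refine Finset.sum_congr rfl fun zbar _ => ?_
  rw [periodise_torusFourierInv_sampled hL a zbar]

/-- **Young after periodisation**: `Σ_{x̄} ‖(ǎ_c ∗ σ_c)(x̄) − Per(ǎ_f ∗ σ_f)(x̄)‖ ≤ ‖ǎ_c‖₁ · Σ_{x̄} ‖σ_c(x̄) − Per σ_f(x̄)‖`. -/
theorem sum_norm_conv_sub_periodise_conv_le (hL : Lf = b * Lc) (a : (Fin d → ℝ) → ℂ) (σc : TorusSite d Lc → ℂ) (σf : TorusSite d Lf → ℂ) :
    ∑ xbar : TorusSite d Lc, ‖(∑ z : TorusSite d Lc, torusFourierInv (fun k => a (latticeMomentum Lc k)) z * σc (xbar - z)) -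
        ∑ y ∈ univ.filter (fun y : TorusSite d Lf => (fun i => (((y i).val : ℕ) : ZMod Lc)) = xbar),
          ∑ z : TorusSite d Lf, torusFourierInv (fun k => a (latticeMomentum Lf k)) z * σf (y - z)‖ ≤
      (∑ z : TorusSite d Lc, ‖torusFourierInv (fun k => a (latticeMomentum Lc k)) z‖) *
        ∑ v : TorusSite d Lc, ‖σc v - ∑ w ∈ univ.filter (fun w : TorusSite d Lf => (fun i => (((w i).val : ℕ) : ZMod Lc)) = v), σf w‖ := by
  have hrw : ∀ xbar : TorusSite d Lc,
      (∑ z : TorusSite d Lc, torusFourierInv (fun k => a (latticeMomentum Lc k)) z * σc (xbar - z)) -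
        ∑ y ∈ univ.filter (fun y : TorusSite d Lf => (fun i => (((y i).val : ℕ) : ZMod Lc)) = xbar),
          ∑ z : TorusSite d Lf, torusFourierInv (fun k => a (latticeMomentum Lf k)) z * σf (y - z) =
      ∑ z : TorusSite d Lc, torusFourierInv (fun k => a (latticeMomentum Lc k)) z *
        (σc (xbar - z) - ∑ w ∈ univ.filter (fun w : TorusSite d Lf => (fun i => (((w i).val : ℕ) : ZMod Lc)) = xbar - z), σf w) := by
    intro xbar
    rw [periodise_conv_sampled hL a σf xbar, ← Finset.sum_sub_distrib]
    refine Finset.sum_congr rfl fun z _ => ?_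
    ring
  simp_rw [hrw]
  exact sum_norm_conv_le _ (fun v => σc v - ∑ w ∈ univ.filter (fun w : TorusSite d Lf => (fun i => (((w i).val : ℕ) : ZMod Lc)) = v), σf w)

/-- The real parts: `Σ_{x̄} |Re g_c(x̄) − Σ_{fib x̄} Re g_f(y)| ≤ Σ_{x̄} ‖g_c(x̄) − Σ_{fib x̄} g_f(y)‖`. -/
theorem sum_abs_re_sub_periodise_re_le (gc : TorusSite d Lc → ℂ) (gf : TorusSite d Lf → ℂ) :
    ∑ xbar : TorusSite d Lc, |(gc xbar).re - ∑ y ∈ univ.filter (fun y : TorusSite d Lf => (fun i => (((y i).val : ℕ) : ZMod Lc)) = xbar), (gf y).re| ≤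
      ∑ xbar : TorusSite d Lc, ‖gc xbar - ∑ y ∈ univ.filter (fun y : TorusSite d Lf => (fun i => (((y i).val : ℕ) : ZMod Lc)) = xbar), gf y‖ := by
  refine Finset.sum_le_sum fun xbar _ => ?_
  rw [← Complex.re_sum, ← Complex.sub_re]
  exact Complex.abs_re_le_norm _

omit [NeZero Lc] in
/-- The real far tail is at most the complex one. -/
theorem sum_far_abs_re_le (gf : TorusSite d Lf → ℂ) :
    ∑ y ∈ univ.filter (fun y : TorusSite d Lf => Torus.proj Lf (Torus.cRep (fun i => (((y i).val : ℕ) : ZMod Lc))) ≠ y), |(gf y).re| ≤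
      ∑ y ∈ univ.filter (fun y : TorusSite d Lf => Torus.proj Lf (Torus.cRep (fun i => (((y i).val : ℕ) : ZMod Lc))) ≠ y), ‖gf y‖ :=
  Finset.sum_le_sum fun _ _ => Complex.abs_re_le_norm _

end Periodise

/-! ## §3 The dressed read-out at two nested volumes -/

section Dressed

variable {b Lc Lf M : ℕ} [NeZero Lc] [NeZero Lf]
variable {P P' : Type*} [Fintype P] [DecidableEq P] [Fintype P'] [DecidableEq P']

/-- **THE DRESSED READ-OUT.**  Nested volumes `Lf = b·Lc` on the common `N`-point time grid; grid representations `G = map S W` (coarse),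
`G' = map S' W'` (fine); a complex continuum symbol `a` sampled on the two momentum grids; even dressed data; base-point–independent rows; the
block embedding `ι` onto the centred block with base point `o` at the origin.  Then for every continuum momentum `q`, with
`ǎ_L = torusFourierInv (a ∘ p_L)`, `T = (Lc−1)/2+1`:
`|(symInterp Lc Re[a·Σ_G]).eval q − (symInterp Lf Re[a·Σ_{G'}]).eval q|`
`≤ ‖ǎ_c‖₁·(2N/|β|)·[Σ_{p₁}‖W(o,p₁) − W'(ιo,ιp₁)‖ + Σ_{p₁'∉range ι}‖W'(ιo,p₁')‖] + 2·(2N/|β|)·(M₁(ǎ_f)·Σ_{p₁'}‖W'(ιo,p₁')‖ + ‖ǎ_f‖₁·Σ_{p₁'} tnorm(x'p₁')‖W'(ιo,p₁')‖)/T`. -/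
theorem abs_eval_symInterp_dressed_sub_le [NeZero M] (hL : Lf = b * Lc) {β : ℝ} (hβ : β ≠ 0) {N : ℕ}
    (x : P → TorusSite 2 Lc) (τ : P → ℝ) (x' : P' → TorusSite 2 Lf) (τ' : P' → ℝ)
    (hP : Fintype.card P = N * Lc ^ 2) (hP' : Fintype.card P' = N * Lf ^ 2)
    (ι : P → P') (hι : Function.Injective ι) (hιx : ∀ p, x' (ι p) = Torus.proj Lf (Torus.cRep (x p))) (hιτ : ∀ p, τ' (ι p) = τ p)
    (hblock : ∀ p' : P', Torus.proj Lf (Torus.cRep (fun i => (((x' p' i).val : ℕ) : ZMod Lc))) = x' p' → p' ∈ Set.range ι)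
    {o : P} (hxo : x o = 0) (W : GrassmannAlgebra ℂ (GridLeg P)) (W' : GrassmannAlgebra ℂ (GridLeg P')) (n : MatsubaraIdx M) (σ : Fin 2)
    (a : (Fin 2 → ℝ) → ℂ)
    (heven : ∀ k : TorusSite 2 Lc, a (latticeMomentum Lc (-k)) *
        selfEnergy Lc M β (ExteriorAlgebra.map (Matrix.toLin' (gridSubMatrix Lc M β x τ)) W) (n, -k) σ =
      a (latticeMomentum Lc k) * selfEnergy Lc M β (ExteriorAlgebra.map (Matrix.toLin' (gridSubMatrix Lc M β x τ)) W) (n, k) σ)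
    (heven' : ∀ k : TorusSite 2 Lf, a (latticeMomentum Lf (-k)) *
        selfEnergy Lf M β (ExteriorAlgebra.map (Matrix.toLin' (gridSubMatrix Lf M β x' τ')) W') (n, -k) σ =
      a (latticeMomentum Lf k) * selfEnergy Lf M β (ExteriorAlgebra.map (Matrix.toLin' (gridSubMatrix Lf M β x' τ')) W') (n, k) σ)
    (hrow : ∀ (p₀ : P) (y : TorusSite 2 Lc),
      (∑ p₁ : P, if x p₁ = x p₀ + y then
        Complex.exp (((matsubaraFreq β M n * (τ p₀ - τ p₁) : ℝ) : ℂ) * Complex.I) * kernel ℂ W 2 (fun i => ((![p₀, p₁] i, σ), i))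
        else 0) =
      ∑ p₁ : P, if x p₁ = x o + y then
        Complex.exp (((matsubaraFreq β M n * (τ o - τ p₁) : ℝ) : ℂ) * Complex.I) * kernel ℂ W 2 (fun i => ((![o, p₁] i, σ), i))
        else 0)
    (hrow' : ∀ (p₀' : P') (y : TorusSite 2 Lf),
      (∑ p₁' : P', if x' p₁' = x' p₀' + y then
        Complex.exp (((matsubaraFreq β M n * (τ' p₀' - τ' p₁') : ℝ) : ℂ) * Complex.I) * kernel ℂ W' 2 (fun i => ((![p₀', p₁'] i, σ), i))
        else 0) =
      ∑ p₁' : P', if x' p₁' = x' (ι o) + y then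
        Complex.exp (((matsubaraFreq β M n * (τ' (ι o) - τ' p₁') : ℝ) : ℂ) * Complex.I) * kernel ℂ W' 2 (fun i => ((![ι o, p₁'] i, σ), i))
        else 0)
    (q : Fin 2 → ℝ) :
    |(symInterp Lc (fun k => (a (latticeMomentum Lc k) *
        selfEnergy Lc M β (ExteriorAlgebra.map (Matrix.toLin' (gridSubMatrix Lc M β x τ)) W) (n, k) σ).re)).eval q -
      (symInterp Lf (fun k => (a (latticeMomentum Lf k) *
        selfEnergy Lf M β (ExteriorAlgebra.map (Matrix.toLin' (gridSubMatrix Lf M β x' τ')) W') (n, k) σ).re)).eval q| ≤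
      (∑ z : TorusSite 2 Lc, ‖torusFourierInv (fun k => a (latticeMomentum Lc k)) z‖) * (2 * N / |β| *
        ((∑ p₁ : P, ‖kernel ℂ W 2 (fun i => ((![o, p₁] i, σ), i)) - kernel ℂ W' 2 (fun i => ((![ι o, ι p₁] i, σ), i))‖) +
          ∑ p₁' ∈ univ.filter (fun p₁' : P' => p₁' ∉ Set.range ι), ‖kernel ℂ W' 2 (fun i => ((![ι o, p₁'] i, σ), i))‖)) +
      2 * (((∑ z : TorusSite 2 Lf, (Torus.tnorm z : ℝ) * ‖torusFourierInv (fun k => a (latticeMomentum Lf k)) z‖) *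
            (2 * N / |β| * ∑ p₁' : P', ‖kernel ℂ W' 2 (fun i => ((![ι o, p₁'] i, σ), i))‖) +
          (∑ z : TorusSite 2 Lf, ‖torusFourierInv (fun k => a (latticeMomentum Lf k)) z‖) *
            (2 * N / |β| * ∑ p₁' : P', (Torus.tnorm (x' p₁') : ℝ) * ‖kernel ℂ W' 2 (fun i => ((![ι o, p₁'] i, σ), i))‖)) /
        (((Lc - 1) / 2 + 1 : ℕ) : ℝ)) := by
  classical
  -- names
  set Sc : TorusSite 2 Lc → ℂ := fun k => selfEnergy Lc M β (ExteriorAlgebra.map (Matrix.toLin' (gridSubMatrix Lc M β x τ)) W) (n, k) σ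
    with hSc
  set Sf : TorusSite 2 Lf → ℂ := fun k => selfEnergy Lf M β (ExteriorAlgebra.map (Matrix.toLin' (gridSubMatrix Lf M β x' τ')) W') (n, k) σ
    with hSf
  set ac : TorusSite 2 Lc → ℂ := torusFourierInv (fun k => a (latticeMomentum Lc k)) with hac
  set af : TorusSite 2 Lf → ℂ := torusFourierInv (fun k => a (latticeMomentum Lf k)) with haf
  set σc : TorusSite 2 Lc → ℂ := torusFourierInv Sc with hσc
  set σf : TorusSite 2 Lf → ℂ := torusFourierInv Sf with hσf
  set gc : TorusSite 2 Lc → ℂ := fun y => ∑ z, ac z * σc (y - z) with hgc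
  set gf : TorusSite 2 Lf → ℂ := fun y => ∑ z, af z * σf (y - z) with hgf
  have hxo' : x' (ι o) = 0 := by rw [hιx, hxo]; exact clift_zero
  have hT : (0 : ℝ) < (((Lc - 1) / 2 + 1 : ℕ) : ℝ) := by positivity
  have hβ0 : 0 < |β| := abs_pos.2 hβ
  -- cosine coefficients as real parts of the convolutions
  have hcc : ∀ y, torusCosCoeff Lc (fun k => (a (latticeMomentum Lc k) * Sc k).re) y = (gc y).re :=
    fun y => torusCosCoeff_dressed_eq_re_conv a Sc heven y
  have hcf : ∀ y, torusCosCoeff Lf (fun k => (a (latticeMomentum Lf k) * Sf k).re) y = (gf y).re :=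
    fun y => torusCosCoeff_dressed_eq_re_conv a Sf heven' y
  -- step 1: the periodised split of the value difference
  have h1 := abs_eval_symInterp_sub_le_periodise_add_two_far hL (fun k => (a (latticeMomentum Lc k) * Sc k).re)
    (fun k => (a (latticeMomentum Lf k) * Sf k).re) q
  simp_rw [hcc, hcf] at h1
  -- step 2: the periodised part through Young and the site-kernel two-volume bound
  have hdef := sum_norm_siteKernel_sub_clift_add_far_le_gridDefect hL hβ x τ x' τ' hP hP' ι hι hιx hιτ hblock hxo W W' n σ hrow hrow'
  have h2 : ∑ xbar : TorusSite 2 Lc, |(gc xbar).re -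
      ∑ y ∈ univ.filter (fun y : TorusSite 2 Lf => (fun i => (((y i).val : ℕ) : ZMod Lc)) = xbar), (gf y).re| ≤
      (∑ z : TorusSite 2 Lc, ‖ac z‖) * (2 * N / |β| *
        ((∑ p₁ : P, ‖kernel ℂ W 2 (fun i => ((![o, p₁] i, σ), i)) - kernel ℂ W' 2 (fun i => ((![ι o, ι p₁] i, σ), i))‖) +
          ∑ p₁' ∈ univ.filter (fun p₁' : P' => p₁' ∉ Set.range ι), ‖kernel ℂ W' 2 (fun i => ((![ι o, p₁'] i, σ), i))‖)) := by
    refine (sum_abs_re_sub_periodise_re_le gc gf).trans ?_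
    refine (sum_norm_conv_sub_periodise_conv_le hL a σc σf).trans ?_
    refine mul_le_mul_of_nonneg_left ?_ (Finset.sum_nonneg fun _ _ => norm_nonneg _)
    exact (sum_norm_sub_periodise_le_pinned_add_far hL σc σf).trans hdef
  -- step 3: the far tail through the first moment of the fine convolution
  have hN2 := sum_norm_siteKernel_le hβ x' τ' hP' W' n σ hxo' hrow'
  have hM2 := sum_tnorm_norm_siteKernel_le hβ x' τ' hP' W' n σ hxo' hrow'
  have h3 : ∑ y ∈ univ.filter (fun y : TorusSite 2 Lf => Torus.proj Lf (Torus.cRep (fun i => (((y i).val : ℕ) : ZMod Lc))) ≠ y), |(gf y).re| ≤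
      ((∑ z : TorusSite 2 Lf, (Torus.tnorm z : ℝ) * ‖af z‖) * (2 * N / |β| * ∑ p₁' : P', ‖kernel ℂ W' 2 (fun i => ((![ι o, p₁'] i, σ), i))‖) +
        (∑ z : TorusSite 2 Lf, ‖af z‖) * (2 * N / |β| * ∑ p₁' : P', (Torus.tnorm (x' p₁') : ℝ) * ‖kernel ℂ W' 2 (fun i => ((![ι o, p₁'] i, σ), i))‖)) /
        (((Lc - 1) / 2 + 1 : ℕ) : ℝ) := by
    refine (sum_far_abs_re_le gf).trans ((sum_far_norm_le_firstMoment_tnorm hL gf).trans ?_)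
    refine div_le_div_of_nonneg_right ((sum_tnorm_norm_conv_le af σf).trans ?_) hT.le
    gcongr
  -- assemble
  exact h1.trans (add_le_add h2 (by linarith))

end Dressed

end Summit.HubbardSuperconductivity.HubbardSuperconductivity.Theorems.TwoVolumeDefect

end
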